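import Literature.AlgebraicGeometry.HodgeTheory.BettiUniverseKunnethHodgePowersNormalForm
import Literature.AlgebraicGeometry.HodgeTheory.HypersurfaceCutOutByLefschetz
import Literature.AlgebraicGeometry.HodgeTheory.OddHypersurfaceHodgeConjecture
import Literature.AlgebraicGeometry.HodgeTheory.ComplexConjugationHolds

/-!
# K2-B stub KS (route `SignSymmetricPowers`, item stmt-HodgeConjecture-19717) — the Künneth summand normal form

Discharges the registered stub `stub_summandHodgeNormalForm` (skeleton `960d9c079ab3`, K2-B line
`kunneth-tensor-fft` v2, active stubs `stub_fultonPullback`, `stub_summandHodgeNormalForm`,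
`stub_matchingClassesAlgebraic`; `stub_fftTensorPort` landed p505067) of the deciding crux
`PowersHodgeOfSignCommutators` (rank 3) of `route-HodgeConjecture-SignSymmetricPowers`; landed
`--supports stmt-HodgeConjecture-19717` (it does not close the item: stubs P and A remain). Sorry-free; axioms
`propext`, `Classical.choice`, `Quot.sound`.

## Statement

`stub_summandHodgeNormalForm` — the registered signature VERBATIM: for an even `d ≥ 4`, a smooth projective
threefold `X` cut out in `ℙ⁴` by a sign-symmetric form of degree `d`, a limit fan `Fan.mk Y π` on `k + 1` copies
of `X`, and a Hodge class `x` (type `(p, p)`) of ONE tensor summand `PowSummand X k κ` (`κ : PowIdx k (2p)`) of the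
Künneth decomposition, the class `fanKunnethMap π hlim (2p) (powInsert X k κ x) ∈ H^{2p}(Y; ℚ)` lies in the
`ℚ`-span of the classes `E t`: `E` a Künneth insertion of covariant tensors of `H³(X)` decorated by a class `wdec`
with algebraic complexification (on basis tensors the left-nested cup chain
`((wdec ∪ π_{u 0}^* b_{w 0}) ∪ π_{u 1}^* b_{w 1}) ∪ ⋯`), `t` a Hodge tensor of `T^{r,0} H³(X)`.

## Proof

The Literature theorem `BettiUniverse.fanKunnethMap_powInsert_mem_span_normalForm`
(`BettiUniverseKunnethHodgePowersNormalForm`: Voisin I Thm. 11.40 / Lemma 11.41 with Deligne's Tate-type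
factors — the summand is `H³(X)^{⊗r} ⊗ L` as a Hodge structure with `L` all-Hodge, plus the cup-chain
bookkeeping) at `n = 3`, fed with `H¹ = H⁵ = 0` and `H^{2a}(X)` algebraic for a smooth hypersurface threefold
(`subsingleton_bettiCohomology_of_odd`, `algebraicClasses_eq_top_threefold`, Voisin II Thm. 1.23 / Cor. 1.25;
the form is non-zero by `IsSmoothProjective.ne_zero_of_isHypersurfaceCutOutBy`). The sign-symmetry and degree
hypotheses of the route are not used.
-/

-- `Summit.HodgeConjecture.HodgeConjecture.Theorems` is the mandated namespace (single-problem summit), which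
-- `linter.dupNamespace` flags; the lakefile turns the linter off tree-wide, restated here for stand-alone checks.
set_option linter.dupNamespace false

noncomputable section

namespace Summit.HodgeConjecture.HodgeConjecture.Theorems.SignSymmetricPowersSummandHodgeNormalForm

open Literature.AlgebraicGeometry.Motives Literature.AlgebraicGeometry.HodgeTheory
open Literature.AlgebraicGeometry.HodgeTheory.BettiUniverse
open CategoryTheory CategoryTheory.Limits

/-- **K2-B stub KS** (`SummandHodgeNormalForm`, registered signature verbatim): the Künneth image of a Hodge class
of one tensor summand of `H^{2p}(X^{k+1})`, `X ⊂ ℙ⁴` a smooth (sign-symmetric) hypersurface threefold, lies in the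
span of the decorated Künneth insertions `E t` of Hodge tensors `t ∈ T^{r,0} H³(X)`. Proof: the generic normal
form `BettiUniverse.fanKunnethMap_powInsert_mem_span_normalForm` at `n = 3`. -/
theorem stub_summandHodgeNormalForm :
    open Literature.AlgebraicGeometry.Motives Literature.AlgebraicGeometry.HodgeTheory Literature.AlgebraicGeometry.HodgeTheory.BettiUniverse CategoryTheory.Limits in Literature.AlgebraicGeometry.HodgeTheory.fulton1998_map_mem_algebraicClasses → ∀ ⦃d : ℕ⦄, Even d → 4 ≤ d → ∀ ⦃X : SchemeOver ℂ⦄ (hX : IsSmoothProjective 3 X), (∃ f : MvPolynomial (Fin 5) ℂ, f.IsHomogeneous d ∧ (∀ e : Fin 5 →₀ ℕ, ¬ Even (e 0 + e 1) → f.coeff e = 0) ∧ IsHypersurfaceCutOutBy 4 f X) → ∀ [Module.Finite ℚ (bettiCohomology X 3)] [HodgeTensorFacts.{0, 0}] ⦃k : ℕ⦄ ⦃Y : SchemeOver ℂ⦄ (π : Fin (k + 1) → (Y ⟶ X)) (hlim : IsLimit (Fan.mk Y π)) (p : ℕ) (κ : PowIdx k (2 * p)) (x : PowSummand X k κ), x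 ∈ (powSummandHodge exists_isReal_hodgeModel_holds hX k κ).hodgeClasses (p : ℤ) → fanKunnethMap π hlim (2 * p) (powInsert X k κ x) ∈ Submodule.span ℚ {x : bettiCohomology Y (2 * p) | ∃ (q r : ℕ) (u : Fin r → Fin (k + 1)) (wdec : bettiCohomology Y (2 * q)) (_ : ofRatClass (ComplexPoints Y) (2 * q) wdec ∈ algebraicClasses Y q) (E : hodgeTensorSpace (bettiCohomology X 3) r 0 →ₗ[ℚ] bettiCohomology Y (2 * p)) (_ : (∀ w : Fin r → Fin (Module.finrank ℚ (bettiCohomology X 3)), (⟨2 * p, E ((PiTensorProduct.tprod ℚ fun i => (Module.finBasis ℚ (bettiCohomology X 3)) (w i)) ⊗ₜ[ℚ] (PiTensorProduct.tprod ℚ fun i : Fin 0 => (Fin.elim0 i : Module.Dual ℚ (bettiCohomology X 3))))⟩ : Σ n, bettiCohomology Y n) = List.foldl (fun (acc : Σ n, bettiCohomology Y n) (i : Fin r) => ⟨acc.1 + 3, cup Y acc.1 3 acc.2 (pull (π (u i)) 3 ((Module.finBasis ℚ (bettiCohomology X 3)) (w i)))⟩) ⟨2 * q, wdec⟩ (List.finRange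 r))) (t : hodgeTensorSpace (bettiCohomology X 3) r 0) (_ : (∃ p' : ℤ, ((r : ℤ) - ((0 : ℕ) : ℤ)) * ((3 : ℕ) : ℤ) = 2 * p' ∧ t ∈ ((hodge exists_isReal_hodgeModel_holds hX 3).tensorSpace r 0).hodgeClasses p')), x = E t} := by
  intro hP d _ _ X hX hf _ _ k Y π hlim p κ x hx
  obtain ⟨f, hfd, -, hcut⟩ := hf
  have hf0 : f ≠ 0 := hX.ne_zero_of_isHypersurfaceCutOutBy hcut
  exact fanKunnethMap_powInsert_mem_span_normalForm exists_isReal_hodgeModel_holds hX hP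
    (fun j hj hjn ↦ subsingleton_bettiCohomology_of_odd (n := 3) hX hfd hf0 hcut hj hjn)
    (fun a _ ↦ algebraicClasses_eq_top_threefold hX hfd hf0 hcut a) π hlim p κ x hx

end Summit.HodgeConjecture.HodgeConjecture.Theorems.SignSymmetricPowersSummandHodgeNormalForm

end
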